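import Summits.QuantumFields.YangMills.Theorems.BalabanUVNodesN15CurvedGluingLocalGauges
import Summits.QuantumFields.YangMills.Theorems.BalabanUVNodesN15TwoSpacingGluingGradientGluing
import HarnessLib

/-!
# N15 = NE2, road (c) — PROGRAMME (PC), towards (PC-A′) «the COVARIANT GRADIENT entries of [B9] (3.42) in per-cube gauges»: A LEFT FACTOR `D` THROUGH THE GLUED OPERATOR BUILT FROM
# PER-CUBE-GAUGE PARAMETRICES — dag-n15-w2's `hasMaj_glued_of_localGauges` with `D∘` in front, the cubes' rows given IN THEIR OWN GAUGES and `D`'s GAUGE COVARIANCE DISPLAYED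
# (dag-n15-c g26, n15-c∕268)

Cell `pub-ymgap`, seat `pub-ymgap-dag-n15-c` (generation g26; R134 (a), s1; HUMAN RULING D-0062).  `bears_on: R4∕N15 · K3⁸ SpineGivenEndpointR13SepCoPHV (stmt-QuantumFields-27366)`.
Filed `--kind proof --supports stmt-QuantumFields-27366 --as helper` — COUNT-NEUTRAL.  Theorems only; 0 `def`, 0 `sorry`.  Imports BY NAME dag-n15-w2 `…CurvedGluingLocalGauges`
(`cutRow_of_localGauge`, `commRow_of_localGauge`, `defectRow_of_localGauge`; through it g4 `mulOp_comp_gaugeConj`, `hasMaj_sandwich_of_entry_le_one`,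
`entry_le_one_of_orthogonal`, `transpose_entry_le_one_of_orthogonal`) and dag-n15-c FILE 136 `…TwoSpacingGluingGradientGluing` (`hasMaj_comp_glued_of_cutRows_defect`).  Nothing in the
tree is modified, no landed name re-declared.

WHY.  n15-c∕266 (`hasMaj_cGreen_of_reg335Box`) is entry 0 of (3.42) for the scalar covariant Green's function `G′(U)` of a `U(m)` field in Bałaban's PRINTED per-cube class (3.35).  Every
locality-in-`U` statement downstream (the Landau letter's `(Q′G′²Q′*)⁻¹`, box-local rows, Thm 3.14-type «change `U` outside a region») carries a factor `n = L^k` when done with entry-0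
rows alone; the `n` is cancelled only by COVARIANT gradient rows `D_UG′(U)` (entries 2–3 of (3.42)) — the FLAT gradient of `G′(U)` is NOT bounded uniformly (a rough gauge has `∇W_k = O(n)`).
The covariant derivative is NOT gauge INVARIANT but gauge COVARIANT: `D_U∘M_{W_kᵀ} = M_{(W_k∘τ)ᵀ}∘D_{U^{w_k}}` — a DIFFERENT orthogonal family on the left.  THIS FILE is the abstract gluing
step for such a left factor: FILE 136's `hasMaj_comp_glued_of_cutRows_defect` (abstract in `D` with a multiplication-type Leibniz rule) for dag-n15-w2's conjugated-back parametrix pieces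
`G_k = M_{W_kᵀ}G′_kM_{W_k}`, with ONE displayed covariance `D∘M_{W_kᵀ} = M_{V_kᵀ}∘D♯_k` (`V_k` orthogonal, `D♯_k` = «`D` read in the cube's gauge») and the cube's `D♯_k`-rows given in
the cube's gauge.

WHAT.  ★ `dcutRow_of_localGauge`: `D♯∘(M_χG′) ≤ 1_S1_S·β₁e^{−δd}` in the cube's gauge and `D∘M_{Wᵀ} = M_{Vᵀ}∘D♯` ⟹ `D∘(M_χ∘(M_{Wᵀ}G′M_W)) ≤ 1_S1_S·|κ|²β₁·e^{−δd}`.  ★★★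
`hasMaj_comp_glued_of_localGauges`: `D∘glueInv (Σ_kM_{h_k}G_kM_{h_k}) (R − Σ_kE_kM_{h_k}) ≤ N_ov(c_s|κ|²β₁ + c_d|κ|²β)(1 − N_ov(|κ|²θ₀ + |κ|²ε)c_r)⁻¹c_r·e^{−(δ−σ)d}` from the four
row families IN THE CUBES' GAUGES (cut rows `β`, `D♯`-cut rows `β₁`, commutator rows `θ₀` of `[Δ^{W_k}, M_{h_k}]G′_k`, defect rows `ε`), the Leibniz rule `D∘M_h = M_{h^s}∘D + M_{dh}`
(`|h^s| ≤ c_s`, `|dh| ≤ c_d` — the covariant derivative satisfies it with `h^s = h∘τ_μ`, `dh = ∇_μh`) and the covariance.  NEXT (located, not here): dag-n15-w3 47's dressed smooth-cut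
cubes with `D♯_k = ∇^±_j + (species letter of U^{w_k} under the cut)` (141a's `hasMaj_fgrad∕bgrad_smoothCutDressed_loc₂` + the letter), then the site instantiation behind n15-c∕266.

HONEST FRAMING ∕ LIMITS.  Abstract bookkeeping over LANDED theorems (model carriers, displayed rows); nothing of [B5]∕[B6]∕[B9] asserted ((2.91)–(2.93) p.239, (2.133)–(2.136) p.247,
(3.34)–(3.35) p.396, (3.42) p.397 = SHAPES ∕ MECHANISM).  NE2⁺ NOT PRINTED, NOT proved; N15 NOT discharged (of record: DISCHARGED AS CONSUMED, p687738); K3⁸ OPEN; counts of record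
UNMOVED (typed 28∕28 · discharged 8∕27); one finite 𝕋⁴ at fixed ε — NOT infinite volume, NOT OS on ℝ⁴, NOT a mass gap, NOT Clay.  Restate-immune (no Theses import).
-/

set_option autoImplicit false

noncomputable section
open scoped BigOperators Matrix
open Finset

namespace Summit.QuantumFields.YangMills.BalabanUVNodes.N15.CurvedSpecies

open Literature.MathematicalPhysics.QuantumFieldTheory.Balaban1983to89
open Literature.MathematicalPhysics.QuantumFieldTheory.Balaban1983to89.B11SectG (BlockNorm HasMaj RowSum)
open Literature.MathematicalPhysics.QuantumFieldTheory.Balaban1983to89.B6RandomWalk (Triangle254)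
open Literature.MathematicalPhysics.QuantumFieldTheory.Balaban1983to89.B6Prop26Gluing (mulOp ind ind_nonneg)
open Summit.QuantumFields.YangMills.BalabanUVNodes.N15.MatrixSpecies (mmulOp liftBlk)
open Summit.QuantumFields.YangMills.BalabanUVNodes.N15.Gluing (parametrix remainder commOp glueInv hasMaj_comp_glued_of_cutRows_defect)

variable {X : Type} [Fintype X] [DecidableEq X] {κ : Type} [Fintype κ] [DecidableEq κ] {K : Type} [Fintype K] {g : B6.Geometry} (blk : X → g.Site) (S : K → Set g.Site)
  (W V : K → X → Matrix κ κ ℝ) (Δ D : (X × κ → ℝ) →ₗ[ℝ] (X × κ → ℝ)) (Dl : K → (X × κ → ℝ) →ₗ[ℝ] (X × κ → ℝ)) (hX χX hsX dhX : K → X → ℝ)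
  (G' E' : K → (X × κ → ℝ) →ₗ[ℝ] (X × κ → ℝ))

/-! ## §1 The `D♯`-cut rows transfer from the cube's gauge to the global gauge under the covariance `D∘M_{Wᵀ} = M_{Vᵀ}∘D♯` -/

section Rows

omit [DecidableEq X] [Fintype K] in
/-- ★ **`D`-CUT ROWS TRANSFER**: `D♯∘(M_χ∘G′) ≤ 1_S1_S·β₁e^{−δd}` in the cube's gauge, `D∘M_{Wᵀ} = M_{Vᵀ}∘D♯`, `WWᵀ = 1`, `VᵀV = 1` ⟹ `D∘(M_χ∘(M_{Wᵀ}G′M_W)) ≤ 1_S1_S·|κ|²β₁·e^{−δd}`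
(the output cut-off commutes with the gauge action; the two DIFFERENT orthogonal factors `M_{Vᵀ}`, `M_W` cost `|κ|²`, g4 `hasMaj_sandwich_of_entry_le_one`).
[cite: Balaban1985BackgroundPropagators, (3.34)–(3.35) p.396, (3.42) p.397 (gradient entries: shape)] -/
theorem dcutRow_of_localGauge (hW : ∀ k x, W k x * (W k x)ᵀ = 1) (hV' : ∀ k x, (V k x)ᵀ * V k x = 1) {β₁ δ : ℝ} (hβ₁ : 0 ≤ β₁) (k : K)
    (hDcov : D ∘ₗ mmulOp (fun x => (W k x)ᵀ) = mmulOp (fun x => (V k x)ᵀ) ∘ₗ Dl k)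
    (hDGc' : HasMaj (BlockNorm.ofBlocks g (liftBlk blk κ)) (BlockNorm.ofBlocks g (liftBlk blk κ)) (Dl k ∘ₗ (mulOp (fun p : X × κ => χX k p.1) ∘ₗ G' k))
      (fun y y' => ind (S k) y * ind (S k) y' * (β₁ * Real.exp (-(δ * g.dist y y'))))) :
    HasMaj (BlockNorm.ofBlocks g (liftBlk blk κ)) (BlockNorm.ofBlocks g (liftBlk blk κ))
      (D ∘ₗ (mulOp (fun p : X × κ => χX k p.1) ∘ₗ (mmulOp (fun x => (W k x)ᵀ) ∘ₗ G' k ∘ₗ mmulOp (W k))))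
      (fun y y' => ind (S k) y * ind (S k) y' * ((Fintype.card κ : ℝ) ^ 2 * β₁ * Real.exp (-(δ * g.dist y y')))) := by
  have e := mulOp_comp_gaugeConj (fun x => (W k x)ᵀ) (χX k) (G' k)
  simp only [Matrix.transpose_transpose] at e
  rw [show (fun x => W k x) = W k from rfl] at e
  rw [e, show D ∘ₗ (mmulOp (fun x => (W k x)ᵀ) ∘ₗ (mulOp (fun p : X × κ => χX k p.1) ∘ₗ G' k) ∘ₗ mmulOp (W k)) =
      mmulOp (fun x => (V k x)ᵀ) ∘ₗ (Dl k ∘ₗ (mulOp (fun p : X × κ => χX k p.1) ∘ₗ G' k)) ∘ₗ mmulOp (W k) by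
    rw [← LinearMap.comp_assoc, ← LinearMap.comp_assoc, hDcov]; simp only [LinearMap.comp_assoc]]
  refine (hasMaj_sandwich_of_entry_le_one blk (fun y y' => ?_) (transpose_entry_le_one_of_orthogonal (hV' k)) (entry_le_one_of_orthogonal (hW k)) hDGc').mono
    fun y y' => le_of_eq (by ring)
  exact mul_nonneg (mul_nonneg (ind_nonneg _ y) (ind_nonneg _ y')) (mul_nonneg hβ₁ (Real.exp_nonneg _))

end Rows

/-! ## §2 FILE 136's gluing of a left factor with the cubes given in their own gauges -/

section Glue

variable {σ cr : ℝ}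

/-- ★★★ **A LEFT FACTOR THROUGH THE GLUED OPERATOR BUILT FROM PER-CUBE-GAUGE PARAMETRICES** — FILE 136 `hasMaj_comp_glued_of_cutRows_defect` for the conjugated-back family
`G_k := M_{W_kᵀ}G′_kM_{W_k}`, `E_k := M_{W_kᵀ}E′_kM_{W_k}`, all four row families given IN THE CUBES' GAUGES (cut rows of `G′_k`, `D♯_k`-cut rows of `G′_k`, commutator rows of
`[Δ^{W_k}, M_{h_k}]G′_k`, defect rows of `E′_k`), the Leibniz rule `D∘M_{h_k} = M_{h^s_k}∘D + M_{dh_k}` and the covariance `D∘M_{W_kᵀ} = M_{V_kᵀ}∘D♯_k`: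
`D∘glueInv (Σ_kM_{h_k}G_kM_{h_k}) (R − Σ_kE_kM_{h_k}) ≤ N_ov(c_s|κ|²β₁ + c_d|κ|²β)(1 − N_ov(|κ|²θ₀ + |κ|²ε)c_r)⁻¹c_r·e^{−(δ−σ)d}`.
[cite: Balaban1985BackgroundPropagators, (3.34)–(3.35) p.396, (3.42) p.397 (gradient entries: shape), (3.87) p.409 (mechanism); Balaban1984PropagatorsII, (2.91)–(2.93) p.239, (2.133)–(2.136) p.247] -/
theorem hasMaj_comp_glued_of_localGauges (htri : Triangle254 g) (hd : ∀ a b : g.Site, 0 ≤ g.dist a b) (hd0 : ∀ y : g.Site, g.dist y y = 0) (hrow : RowSum g σ cr) (hσ : 0 ≤ σ)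
    (hW : ∀ k x, W k x * (W k x)ᵀ = 1) (hW' : ∀ k x, (W k x)ᵀ * W k x = 1) (hV' : ∀ k x, (V k x)ᵀ * V k x = 1) {β β₁ cs cd θ₀ ε δ Nov : ℝ} (hβ : 0 ≤ β) (hβ₁ : 0 ≤ β₁)
    (hcs : 0 ≤ cs) (hcd : 0 ≤ cd) (hθ : 0 ≤ θ₀) (hε : 0 ≤ ε) (hNov : 0 ≤ Nov) (hσδ : 2 * σ ≤ δ)
    (hDcov : ∀ k, D ∘ₗ mmulOp (fun x => (W k x)ᵀ) = mmulOp (fun x => (V k x)ᵀ) ∘ₗ Dl k)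
    (hleib : ∀ k, D ∘ₗ mulOp (fun p : X × κ => hX k p.1) = mulOp (fun p : X × κ => hsX k p.1) ∘ₗ D + mulOp (fun p : X × κ => dhX k p.1))
    (hcut : ∀ k, mulOp (fun p : X × κ => hX k p.1) ∘ₗ mulOp (fun p : X × κ => χX k p.1) = mulOp (fun p : X × κ => hX k p.1)) (hh : ∀ k p, |(fun p : X × κ => hX k p.1) p| ≤ 1)
    (hhs : ∀ k p, |(fun p : X × κ => hsX k p.1) p| ≤ cs) (hdh : ∀ k p, |(fun p : X × κ => dhX k p.1) p| ≤ cd) (hN : ∀ a, ∑ k, ind (S k) a ≤ Nov)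
    (hGc' : ∀ k, HasMaj (BlockNorm.ofBlocks g (liftBlk blk κ)) (BlockNorm.ofBlocks g (liftBlk blk κ)) (mulOp (fun p : X × κ => χX k p.1) ∘ₗ G' k)
      (fun y y' => ind (S k) y * ind (S k) y' * (β * Real.exp (-(δ * g.dist y y')))))
    (hDGc' : ∀ k, HasMaj (BlockNorm.ofBlocks g (liftBlk blk κ)) (BlockNorm.ofBlocks g (liftBlk blk κ)) (Dl k ∘ₗ (mulOp (fun p : X × κ => χX k p.1) ∘ₗ G' k))
      (fun y y' => ind (S k) y * ind (S k) y' * (β₁ * Real.exp (-(δ * g.dist y y')))))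
    (hK' : ∀ k, HasMaj (BlockNorm.ofBlocks g (liftBlk blk κ)) (BlockNorm.ofBlocks g (liftBlk blk κ))
      (commOp (mmulOp (W k) ∘ₗ Δ ∘ₗ mmulOp (fun x => (W k x)ᵀ)) (fun p : X × κ => hX k p.1) ∘ₗ G' k) (fun y y' => ind (S k) y' * (θ₀ * Real.exp (-(δ * g.dist y y')))))
    (hE' : ∀ k, HasMaj (BlockNorm.ofBlocks g (liftBlk blk κ)) (BlockNorm.ofBlocks g (liftBlk blk κ)) (E' k) (fun y y' => ind (S k) y * (ε * Real.exp (-(δ * g.dist y y')))))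
    (hq : Nov * ((Fintype.card κ : ℝ) ^ 2 * θ₀ + (Fintype.card κ : ℝ) ^ 2 * ε) * cr < 1) :
    HasMaj (BlockNorm.ofBlocks g (liftBlk blk κ)) (BlockNorm.ofBlocks g (liftBlk blk κ))
      (D ∘ₗ glueInv (parametrix (fun k => fun p : X × κ => hX k p.1) (fun k => mmulOp (fun x => (W k x)ᵀ) ∘ₗ G' k ∘ₗ mmulOp (W k)))
        (remainder Δ (fun k => fun p : X × κ => hX k p.1) (fun k => mmulOp (fun x => (W k x)ᵀ) ∘ₗ G' k ∘ₗ mmulOp (W k)) -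
          ∑ k, (mmulOp (fun x => (W k x)ᵀ) ∘ₗ E' k ∘ₗ mmulOp (W k)) ∘ₗ mulOp (fun p : X × κ => hX k p.1)))
      (fun y y' => Nov * (cs * ((Fintype.card κ : ℝ) ^ 2 * β₁) + cd * ((Fintype.card κ : ℝ) ^ 2 * β)) *
        (1 - Nov * ((Fintype.card κ : ℝ) ^ 2 * θ₀ + (Fintype.card κ : ℝ) ^ 2 * ε) * cr)⁻¹ * cr * Real.exp (-((δ - σ) * g.dist y y'))) :=
  hasMaj_comp_glued_of_cutRows_defect (liftBlk blk κ) S htri hd hd0 hrow hσ (by positivity) (by positivity) hcs hcd (by positivity) (by positivity) hNov hσδ hleib hcut hh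
    hhs hdh hN (fun k => cutRow_of_localGauge blk S W χX G' hW hW' hβ k (hGc' k)) (fun k => dcutRow_of_localGauge blk S W V D Dl χX G' hW hV' hβ₁ k (hDcov k) (hDGc' k))
    (fun k => commRow_of_localGauge blk S W Δ hX G' hW hW' hθ k (hK' k)) (fun k => defectRow_of_localGauge blk S W E' hW hW' hε k (hE' k)) hq

end Glue

end Summit.QuantumFields.YangMills.BalabanUVNodes.N15.CurvedSpecies
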